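import Summits.BirchSwinnertonDyer.Rank1Residual.X2.RouteGSplitDisplay80934e1Local
import HarnessLib

/-!
# Route G at a SPLIT multiplicative Eisenstein `3` — the DISPLAY on the third pair of record
# `80934e1 @ 3 ← 564b1 @ 3`, Galois side IN THE KERNEL (cell `bsd-eis`, seat `bsd-eis-ky` gen 4; THEOREMS ONLY)

HONEST FRAMING (FULL-BSD rank-≤1 programme D-0033, cell `bsd-eis`, home `run/shared/lean/pub/bsd-eis/`;
row A10-split: 83 cells `(E₀,3)`, `r = 0`, split multiplicative Eisenstein `3`, `¬GVPar`). Nothing booked,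
no label moves: the THIRD keyed pair run through the tree's route G at a split prime
(`X2.mazurMainConjectureAt_of_closedRelative_mult_split_of_facts`, `X2.bsdp_of_closedRelative_mult_rankZero_of_facts`),
template `X2/RouteGSplitDisplay52779b1.lean` (p399495), spec TARGET §1.2 ROUTING v1.8.3 (4)(a). TARGET
`W = 80934e1 = [1,0,1,−118428747,−1678321207562]` (`N = 2·3·7·41·47`; `r_an = 0`; split at `3`;
`(μ_an, λ_an) = (0, 3)`, trivial zero counted), RELATIVE `W' = 564b1 = [0,1,0,−37,71]` (`N' = 2²·3·47`;
`r_an = 1`; split at `3`; `(0, 2)` = λ-minimal), `p = 3`, `S₀ = {2, 7, 41, 47}`. Part 1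
(`X2/RouteGSplitDisplay80934e1Local.lean`) KERNEL-PROVES the equations' ellipticity and global minimality,
every reduction type at `3` and on `S₀`, the point counts `#Ẽ'(𝔽₇) = 9`, `#Ẽ'(𝔽₄₁) = 48`, Greenberg–Vatsal's
local table `(δ(W'), δ(W))` = `(0,1)`, `(2,1)`, `(1,0)`, `(1,1)` at `2, 7, 41, 47`, and the Galois side
(`TorsionIso W W' 3` by Fisher's direct Hesse certificate `(1344 : 29)`, `u = 16`; `¬Irr(W[3])` by the
`Ψ₃`-root `23144`). This file: `3 ∉ S₀`, good reduction of both off `S₀ ∪ {3}`, the shift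
`Σ_{S₀}(δ' − δ) = −1 + 1 + 1 + 0 = 1` (`sum_delta_eq_one`), `k = k' + 1 = 2`, `n = 3 ≤ k + 1` (tight; the
cc-eng-2 prediction `Λ = 3`), and the two displays. PER-PAIR CERTIFICATE HYPOTHESES LEFT [instrument]:
`hr : r_an(W) = 0`, `hr' : r_an(W') = 1` [Cremona]; `hμ0, hlam : (μ_an, λ_an)(W) = (0, 3)` and
`hμ0', hlam' : (0, 2)` [cc tables typer / eng-2 Λ; PARI-ms infeasible at this conductor, kit j239319;
a second reading by the referee's norm engine is available on request]. REGISTERED FACTS (all [PUB]; no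
`_OPEN`, no `@[conjecture]`, no Schneider): `hWu` Wuthrich 2014 Thm 16, `hJs hJn hHs hHn` Stein–Wuthrich 2013,
`hGZK`, `hpar hmod`, `hT hT'` Tate, `hAm hBm` GV 2000 §2, `hF` Greenberg 1999, `hGS` Greenberg–Stevens.
NOT: not K5 (MEMO-4-K5); not a booking of `(80934e1, 3)`.
Refs: [GreenbergVatsal2000] Thm (1.4), Prop (2.4); [Wuthrich2014] Thm 16; [SteinWuthrich2013] Thm 6.1;
[Fisher2012Hessian] Thm 13.2; [SilvermanAEC2009] VII.5.
-/

set_option autoImplicit false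

noncomputable section

open scoped Classical

open WeierstrassCurve NumberField IsDedekindDomain
  Literature.NumberTheory.EllipticCurves
  Literature.NumberTheory.EllipticCurves.ModularForms
  Literature.NumberTheory.EllipticCurves.Rank1Residual
  Literature.NumberTheory.EllipticCurves.Rank1Residual.Typed
  Literature.NumberTheory.EllipticCurves.Rank1Residual.X11RankOneCertificates
  Literature.NumberTheory.EllipticCurves.Wuthrich2014
  Literature.NumberTheory.EllipticCurves.SteinWuthrich2013
  Literature.NumberTheory.EllipticCurves.Greenberg1999
  Literature.NumberTheory.EllipticCurves.GreenbergVatsal2000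
  Summit.BirchSwinnertonDyer.BirchSwinnertonDyer.Rank1Residual.IntModel
  Summit.BirchSwinnertonDyer.BirchSwinnertonDyer.Rank1Residual.X11RankOne
  Summit.BirchSwinnertonDyer.Rank1Residual.X11b
  Summit.BirchSwinnertonDyer.Rank1Residual.X1.CongruenceTransfer
  Summit.BirchSwinnertonDyer.Rank1Residual.X2.LocalDeltaCalculus
  Summit.BirchSwinnertonDyer.Rank1Residual.X2.RouteGSplitDisplay80934e1Local

namespace Summit.BirchSwinnertonDyer.Rank1Residual.X2.RouteGSplitDisplay80934e1

/-! ## §1 The exceptional set `S₀ = {(2), (7), (41), (47)}` -/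

/-- `(natural generator of) v ∈ S₀ ↔ ℓ(v) ∈ {2, 7, 41, 47}`. [folklore] -/
private theorem mem_S₀_iff (v : HeightOneSpectrum (𝓞 ℚ)) :
    v ∈ ({(Rat.HeightOneSpectrum.primesEquiv (R := 𝓞 ℚ)).symm ⟨2, Nat.prime_two⟩,
      (Rat.HeightOneSpectrum.primesEquiv (R := 𝓞 ℚ)).symm ⟨7, by norm_num⟩, (Rat.HeightOneSpectrum.primesEquiv (R := 𝓞 ℚ)).symm ⟨41, by norm_num⟩,
      (Rat.HeightOneSpectrum.primesEquiv (R := 𝓞 ℚ)).symm ⟨47, by norm_num⟩} : Finset (HeightOneSpectrum (𝓞 ℚ))) ↔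
      (Rat.HeightOneSpectrum.primesEquiv (R := 𝓞 ℚ) v : ℕ) = 2 ∨
      (Rat.HeightOneSpectrum.primesEquiv (R := 𝓞 ℚ) v : ℕ) = 7 ∨
      (Rat.HeightOneSpectrum.primesEquiv (R := 𝓞 ℚ) v : ℕ) = 41 ∨
      (Rat.HeightOneSpectrum.primesEquiv (R := 𝓞 ℚ) v : ℕ) = 47 := by
  have key : ∀ (ℓ : ℕ) (hℓ : ℓ.Prime), v = (Rat.HeightOneSpectrum.primesEquiv (R := 𝓞 ℚ)).symm ⟨ℓ, hℓ⟩ ↔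
      (Rat.HeightOneSpectrum.primesEquiv (R := 𝓞 ℚ) v : ℕ) = ℓ := fun ℓ hℓ ↦ by
    rw [Equiv.eq_symm_apply]
    exact ⟨fun h ↦ by rw [h], fun h ↦ Subtype.ext h⟩
  simp only [Finset.mem_insert, Finset.mem_singleton, key]

/-- **`3 ∉ v` for `v ∈ S₀`.** [folklore] -/
theorem three_not_mem_of_mem_S₀ :
    ∀ v ∈ ({(Rat.HeightOneSpectrum.primesEquiv (R := 𝓞 ℚ)).symm ⟨2, Nat.prime_two⟩,
      (Rat.HeightOneSpectrum.primesEquiv (R := 𝓞 ℚ)).symm ⟨7, by norm_num⟩, (Rat.HeightOneSpectrum.primesEquiv (R := 𝓞 ℚ)).symm ⟨41, by norm_num⟩,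
      (Rat.HeightOneSpectrum.primesEquiv (R := 𝓞 ℚ)).symm ⟨47, by norm_num⟩} : Finset (HeightOneSpectrum (𝓞 ℚ))), ((3 : ℕ) : 𝓞 ℚ) ∉ v.asIdeal := by
  intro v hv h3
  have h := Rat.HeightOneSpectrum.primesEquiv_eq_of_natCast_mem v (by norm_num) h3
  rcases (mem_S₀_iff v).mp hv with h' | h' | h' | h' <;> omega

/-- A prime dividing `2^a·3^b·7^c·41^d·47^e` is one of `2, 3, 7, 41, 47`. [folklore] -/
theorem eq_of_prime_dvd {q a b c d e : ℕ} (hq : q.Prime) (h : q ∣ 2 ^ a * 3 ^ b * 7 ^ c * 41 ^ d * 47 ^ e) :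
    q = 2 ∨ q = 3 ∨ q = 7 ∨ q = 41 ∨ q = 47 := by
  have hp : ∀ {r n : ℕ}, r.Prime → q ∣ r ^ n → q = r := fun hr hd ↦
    (Nat.prime_dvd_prime_iff_eq hq hr).mp (hq.dvd_of_dvd_pow hd)
  rcases (Nat.Prime.dvd_mul hq).mp h with h | h
  · rcases (Nat.Prime.dvd_mul hq).mp h with h | h
    · rcases (Nat.Prime.dvd_mul hq).mp h with h | h
      · rcases (Nat.Prime.dvd_mul hq).mp h with h | h
        · exact Or.inl (hp Nat.prime_two h)
        · exact Or.inr (Or.inl (hp Nat.prime_three h))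
      · exact Or.inr (Or.inr (Or.inl (hp (by norm_num) h)))
    · exact Or.inr (Or.inr (Or.inr (Or.inl (hp (by norm_num) h))))
  · exact Or.inr (Or.inr (Or.inr (Or.inr (hp (by norm_num) h))))

/-- **Good reduction of `80934e1` and `564b1` outside `S₀ ∪ {3}`** (`Δ = −2¹⁷·3²⁷·7³·41³·47`, `Δ' = 2⁸·3³·47`;
`v`-unit discriminant). [cite: SilvermanAEC2009, VII.5 Prop. 5.1(a)] -/
theorem good_outside_S₀ (v : HeightOneSpectrum (𝓞 ℚ))
    (hv : v ∉ ({(Rat.HeightOneSpectrum.primesEquiv (R := 𝓞 ℚ)).symm ⟨2, Nat.prime_two⟩,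
      (Rat.HeightOneSpectrum.primesEquiv (R := 𝓞 ℚ)).symm ⟨7, by norm_num⟩, (Rat.HeightOneSpectrum.primesEquiv (R := 𝓞 ℚ)).symm ⟨41, by norm_num⟩,
      (Rat.HeightOneSpectrum.primesEquiv (R := 𝓞 ℚ)).symm ⟨47, by norm_num⟩} : Finset (HeightOneSpectrum (𝓞 ℚ))))
    (h3 : ((3 : ℕ) : 𝓞 ℚ) ∉ v.asIdeal) :
    (⟨1, 0, 1, -118428747, -1678321207562⟩ : WeierstrassCurve ℚ).HasGoodReductionAt v ∧
      (⟨0, 1, 0, -37, 71⟩ : WeierstrassCurve ℚ).HasGoodReductionAt v := by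
  set e := Rat.HeightOneSpectrum.primesEquiv (R := 𝓞 ℚ) with he
  have hq : (e v : ℕ).Prime := (e v).2
  have hne : ¬ ((e v : ℕ) = 2 ∨ (e v : ℕ) = 3 ∨ (e v : ℕ) = 7 ∨ (e v : ℕ) = 41 ∨ (e v : ℕ) = 47) := by
    rintro (h | h | h | h | h)
    · exact hv ((mem_S₀_iff v).mpr (Or.inl h))
    · apply h3
      have hm := Rat.HeightOneSpectrum.natCast_natGenerator_mem v
      have h' : Rat.HeightOneSpectrum.natGenerator v = 3 := h
      rw [h'] at hm
      exact hm
    · exact hv ((mem_S₀_iff v).mpr (Or.inr (Or.inl h)))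
    · exact hv ((mem_S₀_iff v).mpr (Or.inr (Or.inr (Or.inl h))))
    · exact hv ((mem_S₀_iff v).mpr (Or.inr (Or.inr (Or.inr h))))
  have hΔ : ¬ ((e v : ℕ) : ℤ) ∣ (⟨1, 0, 1, -118428747, -1678321207562⟩ : WeierstrassCurve ℤ).Δ := by
    intro h
    rw [intCurve_Δ, Int.natCast_dvd] at h
    have habs : (discOf [1, 0, 1, -118428747, -1678321207562]).natAbs =
        2 ^ 17 * 3 ^ 27 * 7 ^ 3 * 41 ^ 3 * 47 ^ 1 := by
      decide +kernel
    exact hne (eq_of_prime_dvd hq (habs ▸ h))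
  have hΔ' : ¬ ((e v : ℕ) : ℤ) ∣ (⟨0, 1, 0, -37, 71⟩ : WeierstrassCurve ℤ).Δ := by
    intro h
    rw [intCurve_Δ, Int.natCast_dvd] at h
    have habs : (discOf [0, 1, 0, -37, 71]).natAbs = 2 ^ 8 * 3 ^ 3 * 7 ^ 0 * 41 ^ 0 * 47 ^ 1 := by
      decide +kernel
    exact hne (eq_of_prime_dvd hq (habs ▸ h))
  refine ⟨?_, ?_⟩
  · have h := hasGoodReductionAt_map_of_not_dvd _ v hΔ
    exact (map_mk_int 1 0 1 (-118428747) (-1678321207562)) ▸ h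
  · have h := hasGoodReductionAt_map_of_not_dvd _ v hΔ'
    exact (map_mk_int 0 1 0 (-37) 71) ▸ h

/-! ## §2 The shift `Σ_{S₀}(δ' − δ) = 1` -/

/-- Distinct primes give distinct places. [folklore] -/
private theorem pl_ne {ℓ ℓ' : ℕ} (hℓ : ℓ.Prime) (hℓ' : ℓ'.Prime) (h : ℓ ≠ ℓ') :
    (Rat.HeightOneSpectrum.primesEquiv (R := 𝓞 ℚ)).symm ⟨ℓ, hℓ⟩ ≠
      (Rat.HeightOneSpectrum.primesEquiv (R := 𝓞 ℚ)).symm ⟨ℓ', hℓ'⟩ := by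
  intro h'
  have h'' := congrArg (fun v ↦ (Rat.HeightOneSpectrum.primesEquiv (R := 𝓞 ℚ) v : ℕ)) h'
  simp only [Equiv.apply_symm_apply] at h''
  exact h h''

/-- **The shift for `80934e1 ← 564b1` at `3`: `Σ_{v ∈ S₀} (δ(564b1) − δ(80934e1)) = (0 − 1) + (2 − 1) +
(1 − 0) + (1 − 1) = 1`** — Greenberg–Vatsal's local table (part 1), DERIVED in the kernel; `= 1` is the
cc-eng-2 shift of record. [cite: GreenbergVatsal2000, §2 Prop. (2.4), pp. 25–27] -/
theorem sum_delta_eq_one (W W' : WeierstrassCurve ℚ) [W.IsElliptic] [W.IsGloballyMinimal]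
    [W'.IsElliptic] [W'.IsGloballyMinimal] (hW : W = ⟨1, 0, 1, -118428747, -1678321207562⟩)
    (hW' : W' = ⟨0, 1, 0, -37, 71⟩) :
    ∑ v ∈ ({(Rat.HeightOneSpectrum.primesEquiv (R := 𝓞 ℚ)).symm ⟨2, Nat.prime_two⟩,
      (Rat.HeightOneSpectrum.primesEquiv (R := 𝓞 ℚ)).symm ⟨7, by norm_num⟩, (Rat.HeightOneSpectrum.primesEquiv (R := 𝓞 ℚ)).symm ⟨41, by norm_num⟩,
      (Rat.HeightOneSpectrum.primesEquiv (R := 𝓞 ℚ)).symm ⟨47, by norm_num⟩} : Finset (HeightOneSpectrum (𝓞 ℚ))),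
        ((delta W' 3 v : ℤ) - (delta W 3 v : ℤ)) = 1 := by
  subst hW hW'
  obtain ⟨h2', h2⟩ := delta_2
  obtain ⟨h7', h7⟩ := delta_7
  obtain ⟨h41', h41⟩ := delta_41
  have h47 := delta_47
  rw [Finset.sum_insert, Finset.sum_insert, Finset.sum_pair (pl_ne _ _ (by norm_num)), h2', h2, h7', h7,
    h41', h41, h47]
  · norm_num
  · simp only [Finset.mem_insert, Finset.mem_singleton, not_or]
    exact ⟨pl_ne _ _ (by norm_num), pl_ne _ _ (by norm_num)⟩
  · simp only [Finset.mem_insert, Finset.mem_singleton, not_or]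
    exact ⟨pl_ne _ _ (by norm_num), pl_ne _ _ (by norm_num), pl_ne _ _ (by norm_num)⟩

/-! ## §3 The display: Mazur's main conjecture and `BSD(80934e1, 3)` from the λ-minimal relative `564b1` -/

/-- **ROUTE G DISPLAY at a SPLIT Eisenstein `3`: `X2.MazurMainConjectureAt 80934e1 3`**, Galois side in
the kernel. Head `X2.mazurMainConjectureAt_of_closedRelative_mult_split_of_facts`, `S₀ = {(2), (7), (41), (47)}`,
`n = 3` (trivial zero included), relative `564b1` with `(0, 2)`, `k' = 1`, shift `k = 1 + Σ(δ' − δ) = 2`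
(`sum_delta_eq_one`, PROVED), `n ≤ k + 1` tight; relative's MC = THEOREM `X2.mazurMainConjectureAt_of_lamMin`;
`hiso` = `torsionIso_80934e1_564b1`, `hred` = `not_irreducible_80934e1` (PROVED, part 1). CONDITIONAL on
the per-pair INSTRUMENT certificates `hr'`, `hμ0`, `hlam`, `hμ0'`, `hlam'` only; class-level binders are
REGISTERED [PUB] facts; nothing booked. [cite: GreenbergVatsal2000, Thm. (1.4), §1 (5)–(7), §2 Prop. (2.4) pp. 20–27]
[cite: Wuthrich2014, Thm. 16 (p. 397)] [cite: SteinWuthrich2013, Thm. 6.1 (p. 20), clause (1)]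
[cite: Fisher2012Hessian, Thm. 13.2 (n = 3)] -/
theorem mazurMainConjectureAt_80934e1_at_three
    (hWu : thm16_charIdeal_dvd_multiplicative_of_reducible)
    (hJs : thm61_splitMultiplicative) (hJn : thm61_nonsplitMultiplicative)
    (hHs : exists_isSplitMultCanonical) (hHn : exists_isMultCanonical)
    (hGZK : rank_eq_analyticRank_of_analyticRank_le_one)
    (hpar : nonempty_modularParametrizationData)
    (hT : Silverman1994_thmV53_corV54_tateUniformisation.{0})
    (hT' : Silverman1994_thmV53_tateUniformisation.{0})
    (hAm : lambda_nonPrimitive_eq_add_sum_delta_multiplicative)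
    (hBm : datumSelmer_divisible_of_finite_torsionBy) (hF : datumStrictSelmer_lt_datumSelmer_of_split)
    (W W' : WeierstrassCurve ℚ) [W.IsElliptic] [W.IsGloballyMinimal] [W'.IsElliptic]
    [W'.IsGloballyMinimal] (hW : W = ⟨1, 0, 1, -118428747, -1678321207562⟩) (hW' : W' = ⟨0, 1, 0, -37, 71⟩)
    (hr' : W'.analyticRank = 1)
    (hμ0 : AnalyticMuLE W 3 0) (hlam : AnalyticLambdaEq W 3 3)
    (hμ0' : AnalyticMuLE W' 3 0) (hlam' : AnalyticLambdaEq W' 3 2) :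
    X2.MazurMainConjectureAt W 3 := by
  have hδ := sum_delta_eq_one W W' hW hW'
  subst hW hW'
  have hp2 : (3 : ℕ) ≠ 2 := by decide
  have hsplit := split_80934e1
  have hsplit' := split_564b1
  have hmult' := hsplit'.hasMultiplicativeReductionAtPrime
  have hiso := torsionIso_80934e1_564b1
  have hred := not_irreducible_80934e1
  have hred' := not_hasIrreducibleModPGaloisRep_of_torsionIso hiso hred
  -- the relative's main conjecture: λ-minimal split pair of analytic rank 1
  have hMC' : X2.MazurMainConjectureAt (⟨0, 1, 0, -37, 71⟩ : WeierstrassCurve ℚ) 3 :=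
    mazurMainConjectureAt_of_lamMin hWu hJs hJn hHs hHn hGZK _ 3 hp2 hmult' hred' hr'.le hμ0'
      (fun hns ↦ absurd hsplit' hns) (fun _ ↦ by rw [hr']; exact hlam')
  exact mazurMainConjectureAt_of_closedRelative_mult_split_of_facts _ hWu hpar hT hT' hAm hBm hF hp2
    hsplit hred hμ0 hlam hmult' hMC' hμ0' hlam' (show 1 + 1 = 2 from rfl) three_not_mem_of_mem_S₀
    (fun v hv h3 ↦ (good_outside_S₀ v hv h3).1) (fun v hv h3 ↦ (good_outside_S₀ v hv h3).2) hiso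
    (k := 2) (by rw [hδ]; norm_num) le_rfl

/-- **`BSD(80934e1, 3)`** (the A10-split cell's currency) from the same inputs plus Greenberg–Stevens and the
rank-`0` certificate (`X2.bsdp_of_closedRelative_mult_rankZero_of_facts`; shift `k = 1 + 1 = 2`, `n = 3 ≤ k + 1`);
Galois side in the kernel. CONDITIONAL on the per-pair instrument certificates; nothing booked.
[cite: GreenbergVatsal2000, Thm. (1.4), §2 Prop. (2.4)] [cite: Wuthrich2014, Thm. 16 (p. 397)]
[cite: SteinWuthrich2013, Thm. 6.1 (p. 20)] [cite: MazurTateTeitelbaum1986Invent, Ch. II §10 Conjecture (BSD(p)) (p. 38)]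
[cite: Miller2011LMS, Def. 1.1] -/
theorem bsdp_80934e1_at_three
    (hWu : thm16_charIdeal_dvd_multiplicative_of_reducible)
    (hJs : thm61_splitMultiplicative) (hJn : thm61_nonsplitMultiplicative)
    (hHs : exists_isSplitMultCanonical) (hHn : exists_isMultCanonical)
    (hGZK : rank_eq_analyticRank_of_analyticRank_le_one) (hmod : hasEntireLFunction_rat)
    (hpar : nonempty_modularParametrizationData)
    (hT : Silverman1994_thmV53_corV54_tateUniformisation.{0})
    (hT' : Silverman1994_thmV53_tateUniformisation.{0})
    (hAm : lambda_nonPrimitive_eq_add_sum_delta_multiplicative)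
    (hBm : datumSelmer_divisible_of_finite_torsionBy) (hF : datumStrictSelmer_lt_datumSelmer_of_split)
    (W W' : WeierstrassCurve ℚ) [W.IsElliptic] [W.IsGloballyMinimal] [W'.IsElliptic]
    [W'.IsGloballyMinimal] (hW : W = ⟨1, 0, 1, -118428747, -1678321207562⟩) (hW' : W' = ⟨0, 1, 0, -37, 71⟩)
    (hGS : greenberg_stevens (W := W) (p := 3))
    (hr : W.analyticRank = 0) (hr' : W'.analyticRank = 1)
    (hμ0 : AnalyticMuLE W 3 0) (hlam : AnalyticLambdaEq W 3 3)
    (hμ0' : AnalyticMuLE W' 3 0) (hlam' : AnalyticLambdaEq W' 3 2) :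
    BSDp W 3 := by
  have hδ := sum_delta_eq_one W W' hW hW'
  subst hW hW'
  have hp2 : (3 : ℕ) ≠ 2 := by decide
  have hsplit := split_80934e1
  have hsplit' := split_564b1
  have hmult := hsplit.hasMultiplicativeReductionAtPrime
  have hmult' := hsplit'.hasMultiplicativeReductionAtPrime
  have hiso := torsionIso_80934e1_564b1
  have hred := not_irreducible_80934e1
  have hred' := not_hasIrreducibleModPGaloisRep_of_torsionIso hiso hred
  have hMC' : X2.MazurMainConjectureAt (⟨0, 1, 0, -37, 71⟩ : WeierstrassCurve ℚ) 3 :=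
    mazurMainConjectureAt_of_lamMin hWu hJs hJn hHs hHn hGZK _ 3 hp2 hmult' hred' hr'.le hμ0'
      (fun hns ↦ absurd hsplit' hns) (fun _ ↦ by rw [hr']; exact hlam')
  exact bsdp_of_closedRelative_mult_rankZero_of_facts _ hWu hJs hJn hHs hHn hGZK hmod hpar hT hT' hAm
    hBm hF _ _ 3 hGS hp2 hmult hred hr hμ0 hlam hmult' hMC' hμ0' hlam' (fun hns ↦ absurd hsplit' hns)
    (fun _ ↦ show 1 + 1 = 2 from rfl) three_not_mem_of_mem_S₀
    (fun v hv h3 ↦ (good_outside_S₀ v hv h3).1) (fun v hv h3 ↦ (good_outside_S₀ v hv h3).2) hiso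
    (k := 2) (by rw [hδ, if_pos hsplit', if_pos hsplit]; norm_num) (fun hns ↦ absurd hsplit hns)
    (fun _ ↦ le_rfl)

end Summit.BirchSwinnertonDyer.Rank1Residual.X2.RouteGSplitDisplay80934e1

end
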